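import Summits.ABC.IUTFork.Repair.CandInternal2RealHex
import HarnessLib

/-!
# D-0079 RESCUE sub-cell R-H (rung LADDER-ABC:A2.RESCUE.H), ROUND 1 row 8 `datum-class-H-lt-4` — seat abc-iut-rh-typ-8 (pair n = 8 TYPER):
# the DATUM-SIDE HEIGHT CLASS «`H(w) = ord_p(q_E) < 4` at every bad place» and the claim «on this class I06⋆ holds at every admissible `l`»,
# typed as a deciding decl over abc-iut-C-cert-3's `Cor312Prov.pilotDataOfK` currency, with its kernel verdict cells

[R-H candidate, hypothesis — not a fact.] DEFINITION + proof file of the abc-iut cell (rung LADDER-ABC:A2.RESCUE.H; seat abc-iut-rh-typ-8 gen 0,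
R-H ROUND 1 PAIR n = 8 under director-abc 2026-08-26T15:32:46Z / HUMAN RULING D-0107; lead abc-iut-rh-lead g0; tester abc-iut-rh-tst-8; k2 desk
hand rp-m2). TAKES NO SIDE on [IUTchIII] Cor. 3.12 or on any author (Mochizuki / Scholze–Stix / Joshi / Dupuy–Hilado); nothing here asserts
that abc is proved or refuted; the candidate is a claim-tagged `def … : Prop` HYPOTHESIS, never a Literature fact; typed ≠ proved; refuted-AS-TYPED
≠ refuted-in-print. DEFS-FREEZE respected: every cell is decided BY NAME from abc-iut-rp-d2's `CandInternal2RealLabels` (p450037) /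
`CandInternal2RealStrata` (p451037) / `CandInternal2RealHex`, over abc-iut-S1's [IUTchIV] Prop. 1.2 (i) exponents `logRadiusA` / `logRadiusB`;
nothing is restated. Standard axioms.

THE ROW (verbatim, `plan/rescue/R-H/RH-CANDIDATES.tsv` v1.1 f7773e15cd7f6906, one writer abc-iut-rh-lead g0, row 8 `datum-class-H-lt-4`,
harvested from lens-anomaly-2 «l-cancellation: verdict governed by n_v vs 4 e(v|p)» / lens-strengthen-1 «datum-side hypothesis: ramification
absorbs the j²-depth, (l⋆²−1)·ord_v(q_v) ≤ c·e_v»): «DATUM-SIDE class: forall bad v of F: H(v) = ord_p(q_E) = n_v/e(v|p) < 4 (l-free); claim: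
on this class I06⋆ (or the licence) holds at every admissible l — typer must state WHICH (I06⋆ or licence) and at which labels». Scope: «datum class
(restricts initial Theta-data), all l»; cut class G6(b) strengthen; k1 recipe «per row: column H < 4; then compare with i06star_datum / R_dab_margin
on the rows inside the class».

UNITS (= `plan/rescue/R-H/START-HERE.md` v1.2 §1 and `I06STAR-COLUMNS.tsv` header, abc-iut-rp-d2): at a bad place `w | p` of the `K`-level pilot
datum `X := pilotDataOfK D K` ([IUTchI] Ex. 3.2 (iv): the Kummer datum is a `2l`-th root `q̲_w` of the Tate parameter), `e_w := e(w|p)`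
(`w.asIdeal.ramificationIdx ℤ`; `= absRamificationIdx p K_w`, `absRamificationIdx_rescaledCompletion`), `ord_w(q) := X.ordq w`
(`= e(w|v)·ord_v(q_v)`, `Cor312Prov.ordq_baseChange`), and the `ℚ_p`-normalised HEIGHT of the cell `H(w) := ord_w(q)/e_w = ord_v(q_v)/e(v|p) = n_v/e(v|p)`
— `l`-FREE and `F`-level (ramification indices are multiplicative in the tower `K_w ⊇ F_v ⊇ ℚ_p`), with `‖q̲_w‖^{2l} = p^{−H(w)}`; the I06⋆ CELL at
label `j` is «`q̲_w ∈ q̲_w^{j²} · ℐ_w`», `ℐ_w = (p*)⁻¹·log_p(𝒪^×_{K_w})`, demand `h(w,j) = (j²−1)·H(w)/(2l)` against `κ⁻ = c − a_e` (sufficient) /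
`κ⁺ = b_e + c` (necessary).

WHICH READING, AT WHICH LABELS (the row's question, answered by this seat):
* H⋆₈ AS FILED = reading **(a) «class ⟹ I06⋆»**, PLACE-LOCAL form: `HStarI06OfHeightLt 4` — «at every bad place `w` with `H(w) < 4`, for every
  admissible `l`, the I06⋆ cell holds at EVERY label `j ∈ 𝔽_l^⋇`» (§2; the field-universal element-level `Prop`, the shape the k1 columns evaluate:
  one cell per `(p, e_w, H, l, j)`). Its datum-global twin (antecedent = the whole class `HeightClassLt 4 X` of §1) is weaker as a hypothesis on a
  given datum; both are killed below at a genuine datum whose bad place over `7` is in the class (§4), the global one modulo the hand-read heights at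
  the other bad places of `λ₁` (docstring of §4, flagged).
* VERDICT CELLS (kernel): §3 the NAMED table cell `lamSeven:k=1:l=11@p7.j5.ev1` (`(p, e_w, 2l, H, j) = (7, 11, 22, 2, 5)`, `H = 2 < 4`):
  `(25−1)·2 = 48 > 22·(b₁₁ + 1) = 42` ⟹ `q̲ ∉ q̲^{25}·ℐ` for EVERY `K/ℚ_7` with `e = 11` and every `q̲` with `‖q̲‖^{22} = 7^{−2}`
  (`CandInternal2RealStrata.not_mem_pow_smul_logShell_of_root_lt` BY NAME) — reading (a) is false at that cell wherever it is inhabited; the same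
  cell at R-W's CERTIFIED local type `ev30` (`e_w = 330`) is SHAPE-OPEN (`cell_7_330_22_2_25_inside_window`: `22·κ⁻ = 88/5 < 48 ≤ 22·κ⁺ = 1319/15`),
  recorded so that nobody reads the `ev1` kill as a statement about the certified type. §4 the GENUINE, MODEL-FREE kill: at abc-iut-c312-7's genuine
  place `x₀ | 7` of the `λ₁ = 1/2 + 2/7` `K`-line (`‖t_q(x₀)‖ = 7^{−1/l}`, i.e. `H(x₀) = 2 < 4`: IN the class at that place) the TOP-LABEL I06⋆ cell
  FAILS for the admissible primes `l = 67, 71, 101` (abc-iut-rp-d2's `CandInternal2RealHex.i06star_topLabel_false_lamSeven` with `k = 1`, BY NAME),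
  and under R-W's local-model hypothesis A1 (`e(x₀) ≤ 30·l`) already for every prime `19 ≤ l ≤ 68` (`…_A1`, `k = 1`): «at every admissible `l`»
  is refuted at a genuine datum for all large `l`.
* WHAT SURVIVES (theorems, not hypotheses): §5 «`H(w) < c` ⟹ the I06⋆ cells hold at the labels `j ≤ J` with `(J²−1)·c ≤ 2l·(1 − 1/(p−2) − 1/e_w)`»
  (`labels_mem_of_heightLt`, from `allLabels_mem_of_le`) — the class buys exactly the LOW labels (the C1 label cut with `j₀` read off `H < 4`), never
  the binding top label at large `l`; §6 the SHARP CLASS CONSTANTS `c⋆₋(l,w) = 2l·κ⁻/(l⋆²−1)` (sufficient) and `c⋆₊(l,w) = 2l·κ⁺/(l⋆²−1)` (necessary):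
  `exists_topLabel_threshold` — for EVERY capacity `B` and EVERY height `H > 0` there is `l₀` with `8l·B < (l−3)(l+1)·H` for all odd `l ≥ l₀`, whence
  (`topLabel_not_mem_of_ge`) at any fixed place the top-label cell of a `2l`-th root of height `H` FAILS for all large `l`: NO `l`-free height class
  `{H < c}`, `c > 0`, gives reading (a) (the lead's prediction, kernel-checked in the fixed-ramification form; the growing-ramification form at a genuine
  datum is §4).
* Reading **(b) «class ⟹ licence»** is NOT typed here beyond its antecedent `HeightClassLt` (§1): its deciding predicate at a wild packet is R-W's
  verdict column (no closed form in the tree; W task T2a), and on the table of record every in-class G-HEX row is «not refuted» there ⟹ UNTESTED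
  (undecided cells); it is the round-2 variant of record for this row (k2 door: `CandInternal11GapWindow.licence_of_starOn` + a T2a theorem).

k1 (seat-side, exact rationals, recipe of the row; evidence file `HOME/staging/RH/abc-iut-rh-typ-8/K1-row8.md`): class = the `k = 1` rows of the HEX
family (`H = 2k`) + S-X75/X75i/S-RAT/DH67a1; inside the class on `I06STAR-COLUMNS` (v1 rows 2e4c48fd4267a5a7 + DH rows): G-HEX 16 rows — I06⋆ datum
POS 0 / OPEN 10 / NEG 6; HEX strip 32 rows — POS 8 (`l = 5`) / OPEN 18 / NEG 6; concrete 4 rows — POS 3 / NEG 1 (S-RAT) ⟹ reading (a) holds on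
11/52 in-class datum-type rows (21 %), far below the pre-registered 95 %: KILL k1, with §3–§4 as the named cells. HONEST SCOPE: `Fact (Nat.Prime 7)`
is carried as an instance hypothesis where needed (no instance declared); the `ev1` cell is a HYPOTHETICAL local type of R-W's table (realizable as a
local field, not certified as the genuine type); §4 is about OUR typed genuine datum (`Cor22.ThetaVolumeDatumAt (ratPoint λ₁) l`, whose inhabitation
at a given `l` is the admissibility question of R-W, not asserted here). [claim: Mochizuki2012, status: disputed] for every quoted IUT reading;
[cite: MochizukiAbsTopIII2015, Def 5.4 (iii) p. 126]; [cite: Mochizuki2012, IUTchI Ex. 3.2 (iv) p. 71; IUTchIV Prop. 1.2 (i) p. 10].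
-/

noncomputable section

open NumberField IsDedekindDomain

namespace Summit.ABC.IUTFork.Repair.RH.DatumClassHLt4

open Set Metric
open scoped Pointwise
open Thm311 Thm311.Real Cor312 Cor312Prov Literature.IUT.LogVolume Literature.IUT.HodgeTheaters Literature.IUT.LogThetaLattice
  Literature.NumberTheory.NumberFields Literature.NumberTheory.DiophantineGeometry.GenEll Literature.NumberTheory.DiophantineGeometry
  Literature.AnabelianGeometry.AbsoluteAnabelian Summit.ABC.IUTFork.Conditional
  Summit.ABC.IUTFork.Repair.CandInternal2RealLabels Summit.ABC.IUTFork.Repair.CandInternal2RealStrata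
  Summit.ABC.IUTFork.Repair.CandInternal2RealHex

/-! ## §1. The datum-side height class, in `pilotDataOfK` currency -/

section HeightClass

variable {L : Type} [Field L] [NumberField L]

/-- **The DATUM-SIDE HEIGHT CLASS `{H < c}`** of R-H round-1 row 8 [R-H candidate antecedent, hypothesis — not a fact]: a Dupuy–Hilado pilot datum
`X = (L, j_E, S, l)` (intended: abc-iut-C-cert-3's `K`-level datum `Cor312Prov.pilotDataOfK D K` of an initial Θ-datum `D`) lies in the class iff at
EVERY bad place `w ∈ S`, `w | p`, its `ℚ_p`-normalised height `H(w) = ord_w(q)/e(w|p)` is `< c`, i.e. `ord_w(q) < c·e(w|p)` — the row's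
«forall bad v of F: H(v) = ord_p(q_E) = n_v/e(v|p) < 4» at `c = 4` (`l`-free: `ord_w(q) = e(w|v)·ord_v(q_v)` by `Cor312Prov.ordq_baseChange` and
`e(w|p) = e(w|v)·e(v|p)`). A predicate on the typed datum; asserts nothing. [claim: Mochizuki2012, status: disputed] -/
@[claim "Mochizuki2012" "disputed"]
def HeightClassLt (c : ℝ) (X : PilotData L) : Prop :=
  ∀ w ∈ X.S, ((X.ordq w : ℤ) : ℝ) < c * ((w.asIdeal.ramificationIdx ℤ : ℕ) : ℝ)

/-- The class is monotone in the bound. [folklore] -/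
theorem heightClassLt_mono {c c' : ℝ} (hcc' : c ≤ c') {X : PilotData L} (h : HeightClassLt c X) : HeightClassLt c' X := by
  intro w hw
  have he : (0 : ℝ) ≤ ((w.asIdeal.ramificationIdx ℤ : ℕ) : ℝ) := by positivity
  exact (h w hw).trans_le (mul_le_mul_of_nonneg_right hcc' he)

/-- In the class every bad place has POSITIVE height: `0 < ord_w(q)` (`PilotData.ordq_pos`), so the class `{H < c}` is EMPTY for `c ≤ 0` at any datum
— the height of a bad place is never `≤ 0`. [cite: DupuyHilado2025, §3.3] -/
theorem ordq_pos_of_mem {X : PilotData L} {w : HeightOneSpectrum (𝓞 L)} (hw : w ∈ X.S) : (0 : ℝ) < ((X.ordq w : ℤ) : ℝ) := by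
  exact_mod_cast X.ordq_pos hw

/-- Hence a datum in the class `{H < c}` forces `0 < c` (the bad set is non-empty). [cite: DupuyHilado2025, §3.3] -/
theorem pos_of_heightClassLt {c : ℝ} {X : PilotData L} (h : HeightClassLt c X) : 0 < c := by
  obtain ⟨w, hw⟩ := X.S_nonempty
  have h1 := h w hw
  have h0 := ordq_pos_of_mem hw
  have he : (0 : ℝ) < ((w.asIdeal.ramificationIdx ℤ : ℕ) : ℝ) := by
    haveI := w.isPrime
    exact_mod_cast Ideal.ramificationIdx_pos (w.asIdeal) ℤ
  nlinarith

end HeightClass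

/-! ## §2. Reading (a) «class ⟹ I06⋆ at every admissible `l`, every label», as a field-universal cell hypothesis -/

/-- **H⋆₈ = `HStarI06OfHeightLt c`, reading (a) of row 8, PLACE-LOCAL CELL FORM** [R-H candidate, hypothesis — not a fact; seat abc-iut-rh-typ-8]:
for every prime `p`, every complete nontrivially ultrametric-normed `ℚ_p`-algebra `K` (the completion `K_w` at a bad place), every prime `l ≥ 5`
(`l = 2·l⋆ + 1`), every height `0 ≤ H < c` and every `q̲ ∈ K^×` with `‖q̲‖^{2l} = p^{−H}` (the `2l`-th root Kummer datum of a bad place of height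
`H(w) = H`): the content of RP-I06⋆ holds at EVERY label, `q̲ ∈ q̲^{j²} · ℐ_K` for all `j ≤ l⋆`. At `c = 4` this is the row's «on the class `H < 4`,
I06⋆ holds at every admissible `l`» read cell by cell (the k1 columns' currency `(p, e_w, H, l, j)`). KILLED below (§3 named cell, §4 genuine datum).
[claim: Mochizuki2012, status: disputed] -/
@[claim "Mochizuki2012" "disputed"]
def HStarI06OfHeightLt (c : ℝ) : Prop :=
  ∀ (p : ℕ) [Fact p.Prime] (K : Type) [NontriviallyNormedField K] [NormedAlgebra ℚ_[p] K] [IsUltrametricDist K] [ProperSpace K]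
    (k : ℕ), Nat.Prime (2 * k + 1) → 5 ≤ 2 * k + 1 →
    ∀ (H : ℝ), 0 ≤ H → H < c → ∀ (q : K), q ≠ 0 → ‖q‖ ^ (2 * (2 * k + 1)) = (p : ℝ) ^ (-H) →
      ∀ j ≤ k, q ∈ q ^ (j ^ 2) • logShell (PadicLogOnUnits.ofUnitLog p K)

/-- Reading (a) is antitone in the bound: a larger class is a stronger hypothesis. [folklore] -/
theorem hStarI06OfHeightLt_anti {c c' : ℝ} (hcc' : c ≤ c') (h : HStarI06OfHeightLt c') : HStarI06OfHeightLt c := by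
  intro p _ K _ _ _ _ k hk h5 H hH hHc q hq hqN j hj
  exact h p K k hk h5 H hH (hHc.trans_le hcc') q hq hqN j hj

/-- **What a KILL of reading (a) needs: ONE inhabited NEGATIVE cell inside the class.** If some `K/ℚ_p`, prime `l = 2k+1 ≥ 5`, height `0 ≤ H < c`,
`q̲ ≠ 0` with `‖q̲‖^{2l} = p^{−H}` and label `j ≤ l⋆` have `q̲ ∉ q̲^{j²}·ℐ_K`, then `¬ HStarI06OfHeightLt c`. [folklore] -/
theorem not_hStarI06OfHeightLt_of_cell {c : ℝ} (p : ℕ) [Fact p.Prime] (K : Type) [NontriviallyNormedField K] [NormedAlgebra ℚ_[p] K]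
    [IsUltrametricDist K] [ProperSpace K] {k : ℕ} (hk : Nat.Prime (2 * k + 1)) (h5 : 5 ≤ 2 * k + 1) {H : ℝ} (hH : 0 ≤ H) (hHc : H < c)
    {q : K} (hq : q ≠ 0) (hqN : ‖q‖ ^ (2 * (2 * k + 1)) = (p : ℝ) ^ (-H)) {j : ℕ} (hj : j ≤ k)
    (hneg : q ∉ q ^ (j ^ 2) • logShell (PadicLogOnUnits.ofUnitLog p K)) : ¬ HStarI06OfHeightLt c :=
  fun h => hneg (h p K k hk h5 H hH hHc q hq hqN j hj)

/-! ## §3. The NAMED table cell `lamSeven:k=1:l=11@p7.j5.ev1`: `(p, e_w, 2l, H, j) = (7, 11, 22, 2, 5)` — DECIDED-NEG; and its certified-type twin `ev30` -/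

section Cells

/-- `b₁₁ = ⌊log(7·11/6)/log 7⌋ − 1/11 = 10/11` at `p = 7` (`7 ≤ 77/6 < 49`) ([IUTchIV] Prop. 1.2: `b := ⌊log(p·e/(p−1))/log p⌋ − 1/e`).
[claim: Mochizuki2012, status: disputed] -/
theorem logRadiusB_7_11 : logRadiusB 7 11 = 10 / 11 := by
  have h7 : (0 : ℝ) < Real.log 7 := Real.log_pos (by norm_num)
  have hx : ((7 : ℕ) : ℝ) * ((11 : ℕ) : ℝ) / (((7 : ℕ) : ℝ) - 1) = 77 / 6 := by norm_num
  have hlo : Real.log 7 ≤ Real.log (77 / 6) := Real.log_le_log (by norm_num) (by norm_num)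
  have hhi : Real.log (77 / 6) < Real.log (7 ^ 2) := Real.log_lt_log (by norm_num) (by norm_num)
  rw [Real.log_pow] at hhi
  have hfloor : ⌊Real.log (((7 : ℕ) : ℝ) * ((11 : ℕ) : ℝ) / (((7 : ℕ) : ℝ) - 1)) / Real.log ((7 : ℕ) : ℝ)⌋ = 1 := by
    rw [hx, Int.floor_eq_iff]
    push_cast
    refine ⟨?_, ?_⟩
    · rw [le_div_iff₀ h7]; linarith
    · rw [div_lt_iff₀ h7]; push_cast at hhi; linarith
  rw [logRadiusB, hfloor]; norm_num

/-- `a₃₃₀ = ⌈330/5⌉/330 = 1/5` at `p = 7`. [claim: Mochizuki2012, status: disputed] -/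
theorem logRadiusA_7_330 : logRadiusA 7 330 = 1 / 5 := by
  have hceil : ⌈((330 : ℕ) : ℝ) / (((7 : ℕ) : ℝ) - 2)⌉ = 66 := by
    rw [Int.ceil_eq_iff]; norm_num
  rw [logRadiusA, if_neg (by norm_num), hceil]; norm_num

/-- `b₃₃₀ = ⌊log(7·330/6)/log 7⌋ − 1/330 = 3 − 1/330` at `p = 7` (`343 ≤ 385 < 2401`). [claim: Mochizuki2012, status: disputed] -/
theorem logRadiusB_7_330 : logRadiusB 7 330 = 3 - 1 / 330 := by
  have h7 : (0 : ℝ) < Real.log 7 := Real.log_pos (by norm_num)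
  have hx : ((7 : ℕ) : ℝ) * ((330 : ℕ) : ℝ) / (((7 : ℕ) : ℝ) - 1) = 385 := by norm_num
  have hlo : Real.log (7 ^ 3) ≤ Real.log 385 := Real.log_le_log (by norm_num) (by norm_num)
  have hhi : Real.log 385 < Real.log (7 ^ 4) := Real.log_lt_log (by norm_num) (by norm_num)
  rw [Real.log_pow] at hlo hhi
  have hfloor : ⌊Real.log (((7 : ℕ) : ℝ) * ((330 : ℕ) : ℝ) / (((7 : ℕ) : ℝ) - 1)) / Real.log ((7 : ℕ) : ℝ)⌋ = 3 := by
    rw [hx, Int.floor_eq_iff]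
    push_cast
    refine ⟨?_, ?_⟩
    · rw [le_div_iff₀ h7]; push_cast at hlo; linarith
    · rw [div_lt_iff₀ h7]; push_cast at hhi; linarith
  rw [logRadiusB, hfloor]; norm_num

/-- `c = ord₇(p*) = 1`. [cite: MochizukiAbsTopIII2015, Def 5.4 (iii) p. 126] -/
theorem pstarExp_seven : ((if (7 : ℕ) = 2 then 2 else 1 : ℕ) : ℝ) = 1 := pstarExp_of_ne_two (by norm_num)

/-- **The SAME cell at R-W's CERTIFIED local type `ev30` (`e_w = 330`; table row `lamSeven:k=1:l=11@p7.j5.ev30`) is SHAPE-OPEN by valuation alone**: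
`(25−1)·2 = 48` lies strictly above the printed sufficient edge `22·(c − a₃₃₀) = 88/5` and the sharp sufficient edge `22·(c − 1/6) = 55/3`, and below
the necessary edge `22·(b₃₃₀ + c) = 1319/15` — neither `mem_pow_smul_logShell_of_root(_lt_sharp)` nor `not_mem_pow_smul_logShell_of_root_lt` applies
(arithmetic record; START-HERE §1 «shape-open»). [folklore] -/
theorem cell_7_330_22_2_25_inside_window :
    (22 : ℝ) * (1 - logRadiusA 7 330) < (((25 : ℕ) : ℝ) - 1) * 2 ∧
      (22 : ℝ) * (1 - 1 / ((7 : ℝ) - 1)) < (((25 : ℕ) : ℝ) - 1) * 2 ∧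
        (((25 : ℕ) : ℝ) - 1) * 2 ≤ (22 : ℝ) * (logRadiusB 7 330 + 1) := by
  rw [logRadiusA_7_330, logRadiusB_7_330]; norm_num

variable [Fact (Nat.Prime 7)]
variable (K : Type) [NontriviallyNormedField K] [NormedAlgebra ℚ_[7] K] [IsUltrametricDist K] [ProperSpace K]

/-- **THE KILL CELL `(7, 11, 22, 2, 5)` (table row `lamSeven:k=1:l=11@p7.j5.ev1` = `HEX:1:11@p7.j5.ev1`; `H = 2 < 4`, IN the class): DECIDED-NEG** —
for every `K/ℚ_7` with `e = 11` and every `q̲` with `‖q̲‖^{22} = 7^{−2}`, `q̲ ∉ q̲^{25}·ℐ_K` (`22·(b₁₁ + c) = 42 < (25−1)·2 = 48`;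
abc-iut-rp-d2's `not_mem_pow_smul_logShell_of_root_lt` BY NAME). [claim: Mochizuki2012, status: disputed] -/
theorem cell_7_11_22_2_25_not_mem (he : absRamificationIdx 7 K = 11) {q : K} (hqN : ‖q‖ ^ 22 = ((7 : ℕ) : ℝ) ^ (-(2 : ℝ))) :
    q ∉ q ^ 25 • logShell (PadicLogOnUnits.ofUnitLog 7 K) := by
  refine not_mem_pow_smul_logShell_of_root_lt 7 K (N := 22) (by norm_num) hqN ?_
  rw [he, pstarExp_seven, logRadiusB_7_11]; norm_num

/-- **Hence reading (a) FAILS at `c = 4` (indeed at every `c > 2`) as soon as that cell is INHABITED**: any `K/ℚ_7` with `e = 11` holding a `q̲ ≠ 0` with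
`‖q̲‖^{22} = 7^{−2}` (e.g. a uniformizer: `ord = e·H/(2l) = 1`) refutes `HStarI06OfHeightLt c` for every `c > 2` (`l = 11 = 2·5+1`, `j = 5 = l⋆`).
The `ev1` local type is a HYPOTHETICAL type of R-W's table (realizable as a local field — `ℚ_7(7^{1/11})` — but not R-W's certified genuine type at
`k = 1`, which is `ev30`, next lemma); the genuine-datum kill is §4. [claim: Mochizuki2012, status: disputed] -/
theorem not_hStarI06OfHeightLt_of_cell_7_11 {c : ℝ} (hc : 2 < c) (he : absRamificationIdx 7 K = 11) {q : K} (hq : q ≠ 0)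
    (hqN : ‖q‖ ^ 22 = ((7 : ℕ) : ℝ) ^ (-(2 : ℝ))) : ¬ HStarI06OfHeightLt c := by
  intro h
  have hqN' : ‖q‖ ^ (2 * (2 * 5 + 1)) = ((7 : ℕ) : ℝ) ^ (-(2 : ℝ)) := hqN
  have hmem : q ∈ q ^ (5 ^ 2) • logShell (PadicLogOnUnits.ofUnitLog 7 K) :=
    h 7 K 5 (by norm_num) (by norm_num) 2 (by norm_num) hc q hq hqN' 5 le_rfl
  exact cell_7_11_22_2_25_not_mem K he hqN hmem

end Cells

/-! ## §4. The GENUINE, MODEL-FREE kill: the `λ₁ = 1/2 + 2/7` datum (`H(x₀) = 2 < 4` at its bad place over `7`) at large admissible `l` -/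

section Genuine

/-- **READING (a) FAILS AT A GENUINE DATUM IN THE CLASS, MODEL-FREE, `l = 67`.** At abc-iut-c312-7's genuine place `x₀ | 7` of the `K`-line of
`λ₁ = 1/2 + 2/7` (`‖t_q(x₀)‖ = 7^{−1/67}`, i.e. `‖t_q(x₀)‖^{2·67} = 7^{−2}`: height `H(x₀) = 2 < 4` — the place is IN the class) the TOP-LABEL I06⋆ cell
(`j = l⋆ = 33`) FAILS: abc-iut-rp-d2's `CandInternal2RealHex.i06star_topLabel_false_lamSeven` with `k = 1`, `M = 15`
(`7·46080·67·66²·68 < 6·7^15`, `4·67·15 = 4020 ≤ 64·68 = 4352`) BY NAME. (Datum-GLOBAL membership of `λ₁` in the class — heights at its other bad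
places `3, 11` are `≤ 2` by hand from `j(λ) = 256(λ²−λ+1)³/(λ²(λ−1)²)`, `λ = 11/14` — is NOT a kernel statement here; the kill is of the place-local
reading at a genuine place of height `2`.) [cite: Mochizuki2012, IUTchIV Cor. 2.2 (ii) proof (P5) p. 46] [claim: Mochizuki2012, status: disputed] -/
theorem i06star_topLabel_false_lamOne_l67 (T : Cor22.ThetaVolumeDatumAt (ratPoint ((2 : ℚ)⁻¹ + 2 / 7 ^ 1)) 67) :
    letI := T.instFieldF; letI := T.instNumberFieldF; letI := T.instAlgebraF; letI := T.instFieldK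
    letI := T.instNumberFieldK; letI := T.instAlgebraK; letI := T.instFieldFbar; letI := T.instAlgebraFbar
    letI := T.instAlgebraKFbar; letI := T.instIsElliptic
    haveI : Fact (Nat.Prime 7) := ⟨by norm_num⟩
    ∃ x₀ : (thetaIndex (pilotDataOfK T.D T.K)).Fibre (.inr ⟨7, by norm_num⟩),
      placeOf (pilotDataOfK T.D T.K) 7 x₀ ∈ (pilotDataOfK T.D T.K).S ∧
      ‖(exists_realising_qIdeles_pilotDataOfK T.D).choose ⟨7, by norm_num⟩ x₀‖ = (7 : ℝ) ^ (-(((1 : ℕ) : ℝ) / ((67 : ℕ) : ℝ))) ∧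
      (exists_realising_qIdeles_pilotDataOfK T.D).choose ⟨7, by norm_num⟩ x₀ ∉
        (exists_realising_qIdeles_pilotDataOfK T.D).choose ⟨7, by norm_num⟩ x₀ ^ (((67 - 1) / 2) ^ 2) •
          logShell (PadicLogOnUnits.ofUnitLog 7 (kOf (pilotDataOfK T.D T.K) 7 x₀)) :=
  i06star_topLabel_false_lamSeven (k := 1) (l := 67) (M := 15) le_rfl (by norm_num) (by norm_num) (by norm_num) (by norm_num) T

/-- **The same at `l = 101`** (`M = 16`: `7·46080·101·100²·102 < 6·7^16`, `4·101·16 = 6464 ≤ 98·102 = 9996`). [claim: Mochizuki2012, status: disputed] -/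
theorem i06star_topLabel_false_lamOne_l101 (T : Cor22.ThetaVolumeDatumAt (ratPoint ((2 : ℚ)⁻¹ + 2 / 7 ^ 1)) 101) :
    letI := T.instFieldF; letI := T.instNumberFieldF; letI := T.instAlgebraF; letI := T.instFieldK
    letI := T.instNumberFieldK; letI := T.instAlgebraK; letI := T.instFieldFbar; letI := T.instAlgebraFbar
    letI := T.instAlgebraKFbar; letI := T.instIsElliptic
    haveI : Fact (Nat.Prime 7) := ⟨by norm_num⟩
    ∃ x₀ : (thetaIndex (pilotDataOfK T.D T.K)).Fibre (.inr ⟨7, by norm_num⟩),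
      placeOf (pilotDataOfK T.D T.K) 7 x₀ ∈ (pilotDataOfK T.D T.K).S ∧
      ‖(exists_realising_qIdeles_pilotDataOfK T.D).choose ⟨7, by norm_num⟩ x₀‖ = (7 : ℝ) ^ (-(((1 : ℕ) : ℝ) / ((101 : ℕ) : ℝ))) ∧
      (exists_realising_qIdeles_pilotDataOfK T.D).choose ⟨7, by norm_num⟩ x₀ ∉
        (exists_realising_qIdeles_pilotDataOfK T.D).choose ⟨7, by norm_num⟩ x₀ ^ (((101 - 1) / 2) ^ 2) •
          logShell (PadicLogOnUnits.ofUnitLog 7 (kOf (pilotDataOfK T.D T.K) 7 x₀)) :=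
  i06star_topLabel_false_lamSeven (k := 1) (l := 101) (M := 16) le_rfl (by norm_num) (by norm_num) (by norm_num) (by norm_num) T

/-- **Under R-W's local-model hypothesis A1 (`e(x₀) ≤ 30·l`, HYPOTHESIS on the place, never asserted) the genuine `λ₁` top cell already FAILS for
every prime `19 ≤ l ≤ 68`** (`16·l ≤ (l−3)(l+1)` from `l ≥ 19`): abc-iut-rp-d2's `i06star_topLabel_false_A1` with `k = 1` BY NAME — so at the two
`k = 1` rows of the table (`l = 11, 13`) A1 does NOT decide (there `16·l > (l−3)(l+1)`; the certified-type cell is OPEN, §3), while from `l = 19` on it does.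
[claim: Mochizuki2012, status: disputed] -/
theorem i06star_topLabel_false_lamOne_A1 {l : ℕ} (hl : l.Prime) (h19 : 19 ≤ l) (hl68 : l ≤ 68)
    (T : Cor22.ThetaVolumeDatumAt (ratPoint ((2 : ℚ)⁻¹ + 2 / 7 ^ 1)) l) :
    letI := T.instFieldF; letI := T.instNumberFieldF; letI := T.instAlgebraF; letI := T.instFieldK
    letI := T.instNumberFieldK; letI := T.instAlgebraK; letI := T.instFieldFbar; letI := T.instAlgebraFbar
    letI := T.instAlgebraKFbar; letI := T.instIsElliptic
    haveI : Fact (Nat.Prime 7) := ⟨by norm_num⟩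
    ∀ x₀ : (thetaIndex (pilotDataOfK T.D T.K)).Fibre (.inr ⟨7, by norm_num⟩),
      ‖(exists_realising_qIdeles_pilotDataOfK T.D).choose ⟨7, by norm_num⟩ x₀‖ = (7 : ℝ) ^ (-(((1 : ℕ) : ℝ) / l)) →
      absRamificationIdx 7 (kOf (pilotDataOfK T.D T.K) 7 x₀) ≤ 30 * l →
      (exists_realising_qIdeles_pilotDataOfK T.D).choose ⟨7, by norm_num⟩ x₀ ∉
        (exists_realising_qIdeles_pilotDataOfK T.D).choose ⟨7, by norm_num⟩ x₀ ^ (((l - 1) / 2) ^ 2) •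
          logShell (PadicLogOnUnits.ofUnitLog 7 (kOf (pilotDataOfK T.D T.K) 7 x₀)) := by
  have hk : 16 * l ≤ 1 * ((l - 3) * (l + 1)) := by
    have h3 : 3 ≤ l := by omega
    obtain ⟨m, rfl⟩ := Nat.exists_eq_add_of_le h3
    have : 16 * (3 + m) ≤ m * (3 + m + 1) := by nlinarith
    simpa [Nat.add_sub_cancel_left] using this
  exact i06star_topLabel_false_A1 (k := 1) hl (by omega) hl68 hk T

end Genuine

/-! ## §5. What the class DOES buy: the low labels (a theorem, not a hypothesis) -/

section Labels

variable (p : ℕ) [Fact p.Prime]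
variable (K : Type) [NontriviallyNormedField K] [NormedAlgebra ℚ_[p] K] [IsUltrametricDist K] [ProperSpace K]

/-- **«`H < c` ⟹ I06⋆ at the labels `j ≤ J`» whenever `(J²−1)·c ≤ 2l·(1 − 1/(p−2) − 1/e)`** (`p > 2`): the height class certifies exactly the LOW
labels (abc-iut-rp-d2's explicit all-labels edge `allLabels_mem_of_le` BY NAME, with `(J²−1)·H ≤ (J²−1)·c`). At `c = 4` and the binding label `J = l⋆`
the side condition reads `4·(l⋆²−1) ≤ 2l·κ`, false for every `l ≥ 11` at `κ ≤ 1`: the class never reaches the top label of a large `l`.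
[claim: Mochizuki2012, status: disputed] -/
theorem labels_mem_of_heightLt (hp : 2 < p) {c : ℝ} {q : K} (hq : q ≠ 0) {l : ℕ} (hl : 0 < l) {H : ℝ} (hH : 0 ≤ H) (hHc : H < c)
    (hqN : ‖q‖ ^ (2 * l) = (p : ℝ) ^ (-H)) {J : ℕ} (hJ1 : 1 ≤ J)
    (hJ : (((J ^ 2 : ℕ) : ℝ) - 1) * c ≤ ((2 * l : ℕ) : ℝ) * (1 - 1 / ((p : ℝ) - 2) - 1 / (absRamificationIdx p K : ℝ))) :
    ∀ j ≤ J, q ∈ q ^ (j ^ 2) • logShell (PadicLogOnUnits.ofUnitLog p K) := by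
  refine allLabels_mem_of_le p K hp hq hl hH hqN ?_
  have hJsq : 1 ≤ J ^ 2 := Nat.one_le_pow 2 J hJ1
  have hJ0 : (0 : ℝ) ≤ ((J ^ 2 : ℕ) : ℝ) - 1 := by
    have : (1 : ℝ) ≤ ((J ^ 2 : ℕ) : ℝ) := by exact_mod_cast hJsq
    linarith
  exact (mul_le_mul_of_nonneg_left hHc.le hJ0).trans hJ

end Labels

/-! ## §6. The SHARP class constants and «NO `l`-free height class gives reading (a)» -/

section NoLFree

/-- **For every capacity `B` and every height `H > 0` the top-label trigger `8l·B < (l−3)(l+1)·H` holds for all odd `l = 2k+1` beyond an explicit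
threshold** (`k ≥ ⌈6B/H⌉₊ + 2` suffices): the necessary class constant `c⋆₊(l) = 2l·κ⁺/(l⋆²−1) = 8l·κ⁺/((l−3)(l+1))` tends to `0`. Pure real
arithmetic. [folklore] -/
theorem exists_topLabel_threshold (B H : ℝ) (hH : 0 < H) :
    ∃ k₀ : ℕ, ∀ k : ℕ, k₀ ≤ k →
      8 * ((2 * k + 1 : ℕ) : ℝ) * B < ((((2 * k + 1 : ℕ) : ℝ)) - 3) * (((2 * k + 1 : ℕ) : ℝ) + 1) * H := by
  obtain ⟨m, hm⟩ := exists_nat_ge (6 * B / H)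
  refine ⟨m + 2, fun k hk => ?_⟩
  have hmB : 6 * B ≤ (m : ℝ) * H := by
    rw [div_le_iff₀ hH] at hm; linarith
  have hk' : (m : ℝ) + 2 ≤ (k : ℝ) := by exact_mod_cast hk
  have hk0 : (0 : ℝ) ≤ (m : ℝ) := by positivity
  push_cast
  -- `B ≤ (k − 2)·H/6`, and `2(2k+1)(k−2)/3 < k² − 1`
  have h1 : 6 * B ≤ ((k : ℝ) - 2) * H := by nlinarith
  nlinarith [mul_pos hH hH, sq_nonneg ((k : ℝ) - 2), hk', hk0]

variable (p : ℕ) [Fact p.Prime]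
variable (K : Type) [NontriviallyNormedField K] [NormedAlgebra ℚ_[p] K] [IsUltrametricDist K] [ProperSpace K]

/-- **NO `l`-FREE HEIGHT CLASS GIVES READING (a), fixed-ramification form.** At any completion `K` (capacity `B = b_e + c` FIXED) and any height
`H > 0` there is `l₀` such that for every odd `l = 2k+1 ≥ l₀` and every `q̲` with `‖q̲‖^{2l} = p^{−H}` the TOP-LABEL cell FAILS: `q̲ ∉ q̲^{l⋆²}·ℐ_K`
(abc-iut-rp-d2's `not_mem_topLabel_of_large_l` past `exists_topLabel_threshold`). So for every `c > 0` the class `{H < c}` contains heights whose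
I06⋆ top cell fails at all large `l`: the SUFFICIENT class constant of the row is `c⋆₋(l,w) = 2l·κ⁻(w)/(l⋆²−1) → 0` (lead's prediction), kernel-checked
here on the necessary side. (At a genuine datum the ramification grows with `l`; that form is §4, via the print-side bound `e ≤ 46080·l(l−1)²(l+1)`.)
[claim: Mochizuki2012, status: disputed] -/
theorem topLabel_not_mem_of_large_l_eventually {H : ℝ} (hH : 0 < H) :
    ∃ k₀ : ℕ, ∀ k : ℕ, k₀ ≤ k → ∀ q : K, ‖q‖ ^ (2 * (2 * k + 1)) = (p : ℝ) ^ (-H) →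
      q ∉ q ^ (k ^ 2) • logShell (PadicLogOnUnits.ofUnitLog p K) := by
  obtain ⟨k₀, hk₀⟩ := exists_topLabel_threshold
    (logRadiusB p (absRamificationIdx p K) + ((if p = 2 then 2 else 1 : ℕ) : ℝ)) H hH
  exact ⟨k₀, fun k hk q hqN => not_mem_topLabel_of_large_l p K k hqN (hk₀ k hk)⟩

/-- **Corollary: reading (a) with ANY bound `c > 0` is refuted by any place that holds `2l`-th roots of one fixed height `0 < H < c` for all large `l`**
(inhabitation supplied as a hypothesis `hinh`; at genuine data it is [IUTchI] Ex. 3.2 (iv), `Cor312Prov.twoMulLDvdOrdq_pilotDataOfK`, in the growing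
field `K = F(E[l])` — §4 is that form). [claim: Mochizuki2012, status: disputed] -/
theorem not_hStarI06OfHeightLt_of_inhabited {c H : ℝ} (hH : 0 < H) (hHc : H < c)
    (hinh : ∀ k₀ : ℕ, ∃ k : ℕ, k₀ ≤ k ∧ Nat.Prime (2 * k + 1) ∧ 5 ≤ 2 * k + 1 ∧
      ∃ q : K, q ≠ 0 ∧ ‖q‖ ^ (2 * (2 * k + 1)) = (p : ℝ) ^ (-H)) :
    ¬ HStarI06OfHeightLt c := by
  obtain ⟨k₀, hk₀⟩ := topLabel_not_mem_of_large_l_eventually p K hH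
  obtain ⟨k, hk, hprime, h5, q, hq, hqN⟩ := hinh k₀
  exact not_hStarI06OfHeightLt_of_cell p K hprime h5 hH.le hHc hq hqN le_rfl (hk₀ k hk q hqN)

end NoLFree

end Summit.ABC.IUTFork.Repair.RH.DatumClassHLt4

end
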